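import Literature.Algebra.Polynomial.CasasAlvero.Char131Digits
import Literature.Algebra.Polynomial.CasasAlvero.Pentanomial
import Literature.Algebra.Polynomial.CasasAlvero.Degree6CandidatesPrime
import Literature.Algebra.Polynomial.CasasAlvero.Degree5CharPLarge
import Literature.Algebra.Polynomial.CasasAlvero.Degree6
import Literature.Algebra.Polynomial.CasasAlvero.DigitReduction
import HarnessLib

/-!
# Casas-Alvero degrees in characteristic 131: the complete classification — the first digit set that is not an initial segment

Over EVERY field `K` of characteristic `131`: `CA_d(K) ⟺ d = 0 ∨ d = a·131^k` with `a ∈ {1, 2, 3, 4, 6}`.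
For every prime `p ≤ 127` the Casas-Alvero digits form an initial segment `{1, …, N(p)}` (`ClassificationSummary127.lean`); `131` is the first prime
where they do not: the digit `5` is BAD — `131` is one of the nine bad primes `2, 3, 7, 11, 131, 193, 599, 3541, 8009` of degree `5`
([GrafVonBothmerEtAl2007, Prop. 7], [CastryckLaterveerOunaies2012, Thm. 4]; in the tree `Degree5CharPLarge.lean`: the explicit quintic
`X^5 - 10X^3 + 20X^2 - 11X` over `𝔽_131`) — while the digit `6` is GOOD: `131` is not among the `54` candidate bad primes of degree `6`
(`Degree6CandidatesPrime.lean`, `holdsInDegree_six_of_not_mem`; [CastryckLaterveerOunaies2012, Thm. 4]: `53` bad primes for degree `6`).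
Other ingredients: the digit reduction `CA_d ⇒ d = a·p^k ∧ CA_a` (`DigitReduction.lean`, any field); the positive digits `1, 2, 3, 4`
([GrafVonBothmerEtAl2007, Props. 2, 6]); and a refutation of every digit `7 ≤ a ≤ 130` over every field of characteristic `131`:
`28, 43, 55, 58, 61, 73, 82, 83, 85, 96, 101, 103, 105, 107, 108, 111, 112, 115, 121, 126, 127, 130` by the binomial criterion
(`m = 3, 19, 26, 21, 14, 28, 5, 14, 28, 45, 26, 3, 23, 25, 19, 15, 17, 19, 27, 63, 27, 2`), the digit `7` (so `131` is a bad prime for degree `7`, consistent with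
[CastryckLaterveerOunaies2012, Thm. 4]: `127` is the only good prime `< 131` for degree `7` besides `7` itself) and the 101 remaining digits by the sparse `𝔽_131`-examples of `Char131Digits.lean`.
-/

noncomputable section

open Polynomial

set_option maxRecDepth 8192

namespace Literature.Algebra.Polynomial.CasasAlvero

section CharOneHundredThirtyOne

variable (K : Type*) [Field K] [CharP K 131]

/-- `CA_{6·131^k}` over every field of characteristic `131` (`CA_6` itself — the case `k = 0` — holds because `131` is not among the
`54` candidate bad primes of degree `6` of `Degree6CandidatesPrime.lean`, `holdsInDegree_six_of_not_mem`, i.e. `131` is a GOOD prime for degree `6`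
[cite: CastryckLaterveerOunaies2012, Thm. 4]) — although the smaller digit `5` is bad. [cite: GrafVonBothmerEtAl2007, Prop. 6] -/
theorem holdsInDegree_six_mul_pow_of_char_131' (k : ℕ) : HoldsInDegree K (6 * 131 ^ k) := by
  haveI : Fact (Nat.Prime 131) := ⟨by norm_num⟩
  exact holdsInDegree_mul_prime_pow_field K 131 (holdsInDegree_six_of_not_mem (K := AlgebraicClosure K) 131 (by decide)) k

/-- every digit `7 ≤ a < 131` fails: `¬ CA_a` over every field of characteristic `131` — the bad-prime computations of
[cite: CastryckLaterveerOunaies2012, Thm. 4] (degrees `≤ 7`) extended to every digit `7 ≤ a < 131` by explicit `𝔽_131`-rational examples and the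
binomial criterion. [cite: GrafVonBothmerEtAl2007, Prop. 6] -/
theorem not_holdsInDegree_digit_of_char_oneHundredThirtyOne {a : ℕ} (h7 : 7 ≤ a) (hap : a < 131) : ¬ HoldsInDegree K a := by
  haveI : Fact (Nat.Prime 131) := ⟨by norm_num⟩
  interval_cases a
  · exact not_holdsInDegree_seven_of_char_131 K
  · exact not_holdsInDegree_eight_of_char_131 K
  · exact not_holdsInDegree_nine_of_char_131 K
  · exact not_holdsInDegree_ten_of_char_131 K
  · exact not_holdsInDegree_eleven_of_char_131 K
  · exact not_holdsInDegree_twelve_of_char_131 K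
  · exact not_holdsInDegree_thirteen_of_char_131 K
  · exact not_holdsInDegree_fourteen_of_char_131 K
  · exact not_holdsInDegree_fifteen_of_char_131 K
  · exact not_holdsInDegree_sixteen_of_char_131 K
  · exact not_holdsInDegree_seventeen_of_char_131 K
  · exact not_holdsInDegree_eighteen_of_char_131 K
  · exact not_holdsInDegree_nineteen_of_char_131 K
  · exact not_holdsInDegree_twenty_of_char_131 K
  · exact not_holdsInDegree_twentyOne_of_char_131 K
  · exact not_holdsInDegree_twentyTwo_of_char_131 K
  · exact not_holdsInDegree_twentyThree_of_char_131 K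
  · exact not_holdsInDegree_twentyFour_of_char_131 K
  · exact not_holdsInDegree_twentyFive_of_char_131 K
  · exact not_holdsInDegree_twentySix_of_char_131 K
  · exact not_holdsInDegree_twentySeven_of_char_131 K
  · exact not_holdsInDegree_of_choose_modEq_one K 131 (d := 28) (m := 3) (by norm_num) (by norm_num) (by decide)
  · exact not_holdsInDegree_twentyNine_of_char_131 K
  · exact not_holdsInDegree_thirty_of_char_131 K
  · exact not_holdsInDegree_thirtyOne_of_char_131 K
  · exact not_holdsInDegree_thirtyTwo_of_char_131 K
  · exact not_holdsInDegree_thirtyThree_of_char_131 K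
  · exact not_holdsInDegree_thirtyFour_of_char_131 K
  · exact not_holdsInDegree_thirtyFive_of_char_131 K
  · exact not_holdsInDegree_thirtySix_of_char_131 K
  · exact not_holdsInDegree_thirtySeven_of_char_131 K
  · exact not_holdsInDegree_thirtyEight_of_char_131 K
  · exact not_holdsInDegree_thirtyNine_of_char_131 K
  · exact not_holdsInDegree_forty_of_char_131 K
  · exact not_holdsInDegree_fortyOne_of_char_131 K
  · exact not_holdsInDegree_fortyTwo_of_char_131 K
  · exact not_holdsInDegree_of_choose_modEq_one K 131 (d := 43) (m := 19) (by norm_num) (by norm_num) (by decide)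
  · exact not_holdsInDegree_fortyFour_of_char_131 K
  · exact not_holdsInDegree_fortyFive_of_char_131 K
  · exact not_holdsInDegree_fortySix_of_char_131 K
  · exact not_holdsInDegree_fortySeven_of_char_131 K
  · exact not_holdsInDegree_fortyEight_of_char_131 K
  · exact not_holdsInDegree_fortyNine_of_char_131 K
  · exact not_holdsInDegree_fifty_of_char_131 K
  · exact not_holdsInDegree_fiftyOne_of_char_131 K
  · exact not_holdsInDegree_fiftyTwo_of_char_131 K
  · exact not_holdsInDegree_fiftyThree_of_char_131 K
  · exact not_holdsInDegree_fiftyFour_of_char_131 K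
  · exact not_holdsInDegree_of_choose_modEq_one K 131 (d := 55) (m := 26) (by norm_num) (by norm_num) (by decide)
  · exact not_holdsInDegree_fiftySix_of_char_131 K
  · exact not_holdsInDegree_fiftySeven_of_char_131 K
  · exact not_holdsInDegree_of_choose_modEq_one K 131 (d := 58) (m := 21) (by norm_num) (by norm_num) (by decide)
  · exact not_holdsInDegree_fiftyNine_of_char_131 K
  · exact not_holdsInDegree_sixty_of_char_131 K
  · exact not_holdsInDegree_of_choose_modEq_one K 131 (d := 61) (m := 14) (by norm_num) (by norm_num) (by decide)
  · exact not_holdsInDegree_sixtyTwo_of_char_131 K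
  · exact not_holdsInDegree_sixtyThree_of_char_131 K
  · exact not_holdsInDegree_sixtyFour_of_char_131 K
  · exact not_holdsInDegree_sixtyFive_of_char_131 K
  · exact not_holdsInDegree_sixtySix_of_char_131 K
  · exact not_holdsInDegree_sixtySeven_of_char_131 K
  · exact not_holdsInDegree_sixtyEight_of_char_131 K
  · exact not_holdsInDegree_sixtyNine_of_char_131 K
  · exact not_holdsInDegree_seventy_of_char_131 K
  · exact not_holdsInDegree_seventyOne_of_char_131 K
  · exact not_holdsInDegree_seventyTwo_of_char_131 K
  · exact not_holdsInDegree_of_choose_modEq_one K 131 (d := 73) (m := 28) (by norm_num) (by norm_num) (by decide)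
  · exact not_holdsInDegree_seventyFour_of_char_131 K
  · exact not_holdsInDegree_seventyFive_of_char_131 K
  · exact not_holdsInDegree_seventySix_of_char_131 K
  · exact not_holdsInDegree_seventySeven_of_char_131 K
  · exact not_holdsInDegree_seventyEight_of_char_131 K
  · exact not_holdsInDegree_seventyNine_of_char_131 K
  · exact not_holdsInDegree_eighty_of_char_131 K
  · exact not_holdsInDegree_eightyOne_of_char_131 K
  · exact not_holdsInDegree_of_choose_modEq_one K 131 (d := 82) (m := 5) (by norm_num) (by norm_num) (by decide)
  · exact not_holdsInDegree_of_choose_modEq_one K 131 (d := 83) (m := 14) (by norm_num) (by norm_num) (by decide)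
  · exact not_holdsInDegree_eightyFour_of_char_131 K
  · exact not_holdsInDegree_of_choose_modEq_one K 131 (d := 85) (m := 28) (by norm_num) (by norm_num) (by decide)
  · exact not_holdsInDegree_eightySix_of_char_131 K
  · exact not_holdsInDegree_eightySeven_of_char_131 K
  · exact not_holdsInDegree_eightyEight_of_char_131 K
  · exact not_holdsInDegree_eightyNine_of_char_131 K
  · exact not_holdsInDegree_ninety_of_char_131 K
  · exact not_holdsInDegree_ninetyOne_of_char_131 K
  · exact not_holdsInDegree_ninetyTwo_of_char_131 K
  · exact not_holdsInDegree_ninetyThree_of_char_131 K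
  · exact not_holdsInDegree_ninetyFour_of_char_131 K
  · exact not_holdsInDegree_ninetyFive_of_char_131 K
  · exact not_holdsInDegree_of_choose_modEq_one K 131 (d := 96) (m := 45) (by norm_num) (by norm_num) (by decide)
  · exact not_holdsInDegree_ninetySeven_of_char_131 K
  · exact not_holdsInDegree_ninetyEight_of_char_131 K
  · exact not_holdsInDegree_ninetyNine_of_char_131 K
  · exact not_holdsInDegree_oneHundred_of_char_131 K
  · exact not_holdsInDegree_of_choose_modEq_one K 131 (d := 101) (m := 26) (by norm_num) (by norm_num) (by decide)
  · exact not_holdsInDegree_oneHundredTwo_of_char_131 K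
  · exact not_holdsInDegree_of_choose_modEq_one K 131 (d := 103) (m := 3) (by norm_num) (by norm_num) (by decide)
  · exact not_holdsInDegree_oneHundredFour_of_char_131 K
  · exact not_holdsInDegree_of_choose_modEq_one K 131 (d := 105) (m := 23) (by norm_num) (by norm_num) (by decide)
  · exact not_holdsInDegree_oneHundredSix_of_char_131 K
  · exact not_holdsInDegree_of_choose_modEq_one K 131 (d := 107) (m := 25) (by norm_num) (by norm_num) (by decide)
  · exact not_holdsInDegree_of_choose_modEq_one K 131 (d := 108) (m := 19) (by norm_num) (by norm_num) (by decide)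
  · exact not_holdsInDegree_oneHundredNine_of_char_131 K
  · exact not_holdsInDegree_oneHundredTen_of_char_131 K
  · exact not_holdsInDegree_of_choose_modEq_one K 131 (d := 111) (m := 15) (by norm_num) (by norm_num) (by decide)
  · exact not_holdsInDegree_of_choose_modEq_one K 131 (d := 112) (m := 17) (by norm_num) (by norm_num) (by decide)
  · exact not_holdsInDegree_oneHundredThirteen_of_char_131 K
  · exact not_holdsInDegree_oneHundredFourteen_of_char_131 K
  · exact not_holdsInDegree_of_choose_modEq_one K 131 (d := 115) (m := 19) (by norm_num) (by norm_num) (by decide)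
  · exact not_holdsInDegree_oneHundredSixteen_of_char_131 K
  · exact not_holdsInDegree_oneHundredSeventeen_of_char_131 K
  · exact not_holdsInDegree_oneHundredEighteen_of_char_131 K
  · exact not_holdsInDegree_oneHundredNineteen_of_char_131 K
  · exact not_holdsInDegree_oneHundredTwenty_of_char_131 K
  · exact not_holdsInDegree_of_choose_modEq_one K 131 (d := 121) (m := 27) (by norm_num) (by norm_num) (by decide)
  · exact not_holdsInDegree_oneHundredTwentyTwo_of_char_131 K
  · exact not_holdsInDegree_oneHundredTwentyThree_of_char_131 K
  · exact not_holdsInDegree_oneHundredTwentyFour_of_char_131 K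
  · exact not_holdsInDegree_oneHundredTwentyFive_of_char_131 K
  · exact not_holdsInDegree_of_choose_modEq_one K 131 (d := 126) (m := 63) (by norm_num) (by norm_num) (by decide)
  · exact not_holdsInDegree_of_choose_modEq_one K 131 (d := 127) (m := 27) (by norm_num) (by norm_num) (by decide)
  · exact not_holdsInDegree_oneHundredTwentyEight_of_char_131 K
  · exact not_holdsInDegree_oneHundredTwentyNine_of_char_131 K
  · exact not_holdsInDegree_of_choose_modEq_one K 131 (d := 130) (m := 2) (by norm_num) (by norm_num) (by decide)

/-- the positive digits `1 ≤ a ≤ 4`: `CA_{a·131^k}` over every field of characteristic `131`. [cite: GrafVonBothmerEtAl2007, Props. 2, 6] -/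
theorem holdsInDegree_mul_oneHundredThirtyOne_pow_of_le_four {a : ℕ} (ha0 : 0 < a) (ha4 : a ≤ 4) (k : ℕ) :
    HoldsInDegree K (a * 131 ^ k) := by
  haveI : Fact (Nat.Prime 131) := ⟨by norm_num⟩
  interval_cases a
  · simpa using holdsInDegree_prime_pow_field K 131 k
  · exact holdsInDegree_two_mul_prime_pow_field K 131 k
  · exact holdsInDegree_three_mul_prime_pow_field K 131 (by norm_num) k
  · exact holdsInDegree_mul_prime_pow_field K 131
      (holdsInDegree_of_le_four_of_charP (AlgebraicClosure K) 131 (by norm_num) le_rfl) k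

/-- **characteristic 131, complete**: over every field of characteristic `131`,
`CA_d ⟺ d = 0 ∨ d = a·131^k` with `a ∈ {1, 2, 3, 4, 6}` — NOT an initial segment of digits (`5` is bad, `6` is good).
[cite: GrafVonBothmerEtAl2007, Props. 2, 6, 7] [cite: CastryckLaterveerOunaies2012, Thm. 4] -/
theorem classification_char_oneHundredThirtyOne_complete (d : ℕ) :
    HoldsInDegree K d ↔ d = 0 ∨ ∃ k a : ℕ, a ∈ ({1, 2, 3, 4, 6} : Finset ℕ) ∧ d = a * 131 ^ k := by
  haveI : Fact (Nat.Prime 131) := ⟨by norm_num⟩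
  constructor
  · intro h
    rcases Nat.eq_zero_or_pos d with rfl | hd
    · exact Or.inl rfl
    obtain ⟨k, a, ha0, hap, rfl, ha⟩ := digit_of_holdsInDegree K 131 hd.ne' h
    refine Or.inr ⟨k, a, ?_, rfl⟩
    by_cases ha4 : a ≤ 4
    · interval_cases a <;> simp
    · by_cases ha5 : a = 5
      · subst ha5
        exact absurd ha (not_holdsInDegree_five_of_charP_large K 131 (Or.inl rfl))
      · by_cases ha6 : a = 6
        · subst ha6
          simp
        · exfalso
          exact not_holdsInDegree_digit_of_char_oneHundredThirtyOne K (by omega) hap ha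
  · rintro (rfl | ⟨k, a, ha, rfl⟩)
    · exact holdsInDegree_zero K
    · simp only [Finset.mem_insert, Finset.mem_singleton] at ha
      rcases ha with rfl | rfl | rfl | rfl | rfl
      · exact holdsInDegree_mul_oneHundredThirtyOne_pow_of_le_four K (by norm_num) (by norm_num) k
      · exact holdsInDegree_mul_oneHundredThirtyOne_pow_of_le_four K (by norm_num) (by norm_num) k
      · exact holdsInDegree_mul_oneHundredThirtyOne_pow_of_le_four K (by norm_num) (by norm_num) k
      · exact holdsInDegree_mul_oneHundredThirtyOne_pow_of_le_four K (by norm_num) (by norm_num) k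
      · exact holdsInDegree_six_mul_pow_of_char_131' K k

/-- the same classification in interval form (`1 ≤ a ≤ 6`, `a ≠ 5`), convenient for one-statement summaries over several characteristics.
[cite: GrafVonBothmerEtAl2007, Props. 2, 6, 7] [cite: CastryckLaterveerOunaies2012, Thm. 4] -/
theorem classification_char_oneHundredThirtyOne_complete' (d : ℕ) :
    HoldsInDegree K d ↔ d = 0 ∨ ∃ k a : ℕ, 0 < a ∧ a ≤ 6 ∧ a ≠ 5 ∧ d = a * 131 ^ k := by
  rw [classification_char_oneHundredThirtyOne_complete]
  have key : ∀ a : ℕ, a ∈ ({1, 2, 3, 4, 6} : Finset ℕ) ↔ 0 < a ∧ a ≤ 6 ∧ a ≠ 5 := by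
    intro a
    simp only [Finset.mem_insert, Finset.mem_singleton]
    omega
  simp only [key, and_assoc]

/-- **not an initial segment**: in characteristic `131` the digit `6` is Casas-Alvero while the smaller digit `5` is not — the first prime
characteristic where the Casas-Alvero digits fail to be `{1, …, N}` (compare `ClassificationSummary127.lean`).
[cite: CastryckLaterveerOunaies2012, Thm. 4] -/
theorem holdsInDegree_six_and_not_five_of_char_131 : HoldsInDegree K 6 ∧ ¬ HoldsInDegree K 5 :=
  ⟨by simpa using holdsInDegree_six_mul_pow_of_char_131' K 0, not_holdsInDegree_five_of_charP_large K 131 (Or.inl rfl)⟩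

/-- the set of Casas-Alvero degrees `≤ 17161` in characteristic `131`, explicitly (corollary of the classification:
[cite: GrafVonBothmerEtAl2007, Prop. 6] with [cite: CastryckLaterveerOunaies2012, Thm. 4] and the digit refutations above). -/
theorem holdsInDegree_iff_mem_of_le_char_oneHundredThirtyOne_sq {d : ℕ} (hd : d ≤ 17161) :
    HoldsInDegree K d ↔ d ∈ ({0, 1, 2, 3, 4, 6, 131, 262, 393, 524, 786, 17161} : Finset ℕ) := by
  rw [classification_char_oneHundredThirtyOne_complete]
  constructor
  · rintro (rfl | ⟨k, a, ha, rfl⟩)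
    · decide
    · simp only [Finset.mem_insert, Finset.mem_singleton] at ha
      rcases k with _ | _ | _ | k
      · rcases ha with rfl | rfl | rfl | rfl | rfl <;> decide
      · rcases ha with rfl | rfl | rfl | rfl | rfl <;> decide
      · rcases ha with rfl | rfl | rfl | rfl | rfl <;> simp_all
      · exfalso
        have ha0 : 0 < a := by rcases ha with rfl | rfl | rfl | rfl | rfl <;> norm_num
        have : 131 ^ 3 ≤ a * 131 ^ (k + 1 + 1 + 1) :=
          le_trans (Nat.pow_le_pow_right (by norm_num) (by omega)) (Nat.le_mul_of_pos_left _ ha0)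
        omega
  · intro h
    simp only [Finset.mem_insert, Finset.mem_singleton] at h
    rcases h with rfl | rfl | rfl | rfl | rfl | rfl | rfl | rfl | rfl | rfl | rfl | rfl
    · exact Or.inl rfl
    · exact Or.inr ⟨0, 1, by simp, by norm_num⟩
    · exact Or.inr ⟨0, 2, by simp, by norm_num⟩
    · exact Or.inr ⟨0, 3, by simp, by norm_num⟩
    · exact Or.inr ⟨0, 4, by simp, by norm_num⟩
    · exact Or.inr ⟨0, 6, by simp, by norm_num⟩
    · exact Or.inr ⟨1, 1, by simp, by norm_num⟩
    · exact Or.inr ⟨1, 2, by simp, by norm_num⟩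
    · exact Or.inr ⟨1, 3, by simp, by norm_num⟩
    · exact Or.inr ⟨1, 4, by simp, by norm_num⟩
    · exact Or.inr ⟨1, 6, by simp, by norm_num⟩
    · exact Or.inr ⟨2, 1, by simp, by norm_num⟩

end CharOneHundredThirtyOne

end Literature.Algebra.Polynomial.CasasAlvero
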